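import Mathlib.GroupTheory.Index
import Mathlib.GroupTheory.Perm.Cycle.Type
import Mathlib.RingTheory.Coprime.Lemmas
import Literature.NumberTheory.Automorphic.BrandtMatrixClassFunction
import Literature.NumberTheory.Automorphic.BrandtMatrixOne
import Literature.NumberTheory.Automorphic.BrandtMatrixUnitCount
import HarnessLib

/-!
# Multiplicativity of Brandt matrices `T(mn) = T(m) T(n)` for coprime `m, n`, from the
# invertibility of intermediate lattices (Eichler's unique-factorisation argument, made
# conditional on its one arithmetic input)

Topic `NumberTheory/Automorphic`; theorems only (no definition, no named fact, no instance).
A brick of the Brandt-module side of Pollack–Weston 2011, Thm. 6.8 (identification (iv) of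
`PollackWestonCongruence.lean`: the Hecke algebra `𝕋` acting on `Pic(X_{N⁺,N⁻}) = ℤ[Cls O]`), and
of the named facts `brandtMatrix_mul_of_coprime` / `brandtMatrix_comm` of `BrandtModule.lean`
(Vignéras III §5 Ex. 5.8 (c)–(d): `P(A) P(B) = P(AB)` si `(A, B) = 1`; Eichler 1973 II §6
Thm. 2 (18), (23): unique factorisation of an integral ideal of norm `n₁ n₂` into ideals of
norms `n₁`, `n₂`).

In the sub-lattice form of the tree (`Brandt.matrix`: `T(n)_ij = #{M ⊆ I_j : [I_j : M] = n²,
M = α I_i}`), Eichler's argument reads: a sub-ideal `M ⊆ I_j` of index `(mn)²` with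
`gcd(m, n) = 1` has a **unique** intermediate lattice `M ⊆ L ⊆ I_j` with `[I_j : L] = n²`,
`[L : M] = m²` — pure group theory: `L / M` is the `m`-primary part of `I_j / M`
(`exists_unique_intermediate_of_coprime`) — so that `T(mn)_ij = Σ_L #{M ⊆ L : …} = Σ_k
T(m)_ik T(n)_kj`, *provided* `L` is again an invertible right `O`-ideal, i.e. lies in some class
`k`. That proviso (true for Eichler orders: `L` agrees locally with `M` or with `I_j`, hence is
locally principal) is the local input and is NOT proved here; it is carried as the hypothesis
"intermediate lattices of coprime indices between invertible right `O`-ideals are invertible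
right `O`-ideals", together with the closure of `Brandt.rightIdeals O` under left translation by
units (automatic in division algebras, `BrandtModuleDictionary.lean`).

* `relIndex_nsmul_mem`, `coprime_relIndex_of_nsmul_le`, `exists_unique_intermediate_of_coprime`
  — the group theory of finite-index sublattices of coprime indices;
* `Brandt.nonempty_equiv_pairs` — `{M ⊆ I_j : [I_j : M] = (mn)², M ∈ Dˣ I_i}` is in bijection
  with the pairs `(L, M)`, `L ⊆ I_j` invertible of index `n²`, `M ⊆ L` of index `m²`,
  `M ∈ Dˣ I_i`;
* `Brandt.card_pairs_eq_sum` — the pairs are counted by `Σ_k T(m)_ik T(n)_kj` (group the `L` by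
  their class; `T(m)` may be computed on the representative `L`, `matrix_apply_eq_ncard`);
* `Brandt.matrix_mul_of_coprime_of_forall_mem_rightIdeals` — **`T(mn) = T(m) T(n)`** for
  coprime `m, n` under the two hypotheses, and `Brandt.matrix_comm_of_coprime_of_forall_mem_rightIdeals`
  — **`T(m) T(n) = T(n) T(m)`**.

## References

* M.-F. Vignéras, *Arithmétique des algèbres de quaternions*, LNM 800 (1980), Ch. III §5
  exercice 5.8 (c)–(d) [VignerasLNM800].
* M. Eichler, LNM 320 (1973), Ch. II §6 Thm. 2 (18), (23) [Eichler1973].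
* A. Pizer, J. Algebra 64 (1980), §2 [Pizer1980].
-/

noncomputable section

open scoped Pointwise

universe u

namespace Literature.NumberTheory.Automorphic

/-! ### Sublattices of coprime indices -/

section Intermediate

variable {M : Type*} [AddCommGroup M]

/-- `[K : J] • x ∈ J` for `x ∈ K` (Lagrange in `K / J`). [folklore] -/
theorem relIndex_nsmul_mem {J K : Submodule ℤ M} {x : M} (hx : x ∈ K) :
    (J.toAddSubgroup.relIndex K.toAddSubgroup) • x ∈ J := by
  have h := AddSubgroup.nsmul_index_mem (J.toAddSubgroup.addSubgroupOf K.toAddSubgroup) ⟨x, hx⟩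
  rw [AddSubgroup.mem_addSubgroupOf] at h
  exact h

/-- If `a • K ⊆ J ⊆ K` with `[K : J]` finite and `gcd(a, b) = 1`, then `gcd([K : J], b) = 1`: a
prime `p ∣ [K : J]` is the order of an element of `K / J` (Cauchy), which is killed by `a`. [folklore] -/
theorem coprime_relIndex_of_nsmul_le {J K : Submodule ℤ M} {a b : ℕ}
    (hab : Nat.Coprime a b) (ha : ∀ x ∈ K, a • x ∈ J)
    (hfin : J.toAddSubgroup.relIndex K.toAddSubgroup ≠ 0) :
    Nat.Coprime (J.toAddSubgroup.relIndex K.toAddSubgroup) b := by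
  refine Nat.coprime_of_dvd fun p hp hpidx hpb => ?_
  haveI : Fact p.Prime := ⟨hp⟩
  set H := J.toAddSubgroup.addSubgroupOf K.toAddSubgroup with hH
  have hidx : J.toAddSubgroup.relIndex K.toAddSubgroup = H.index := rfl
  rw [hidx] at hpidx hfin
  haveI : Finite (K.toAddSubgroup ⧸ H) := AddSubgroup.index_ne_zero_iff_finite.mp hfin
  rw [AddSubgroup.index_eq_card] at hpidx
  obtain ⟨q, hq⟩ := exists_prime_addOrderOf_dvd_card' (G := K.toAddSubgroup ⧸ H) p hpidx
  induction q using QuotientAddGroup.induction_on with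
  | H y =>
    have hkill : a • (y : K.toAddSubgroup ⧸ H) = 0 := by
      rw [← QuotientAddGroup.mk_nsmul, QuotientAddGroup.eq_zero_iff, hH, AddSubgroup.mem_addSubgroupOf]
      exact ha y y.2
    have hpa : p ∣ a := by
      rw [← hq]
      exact addOrderOf_dvd_iff_nsmul_eq_zero.mpr hkill
    have hp1 : p ∣ Nat.gcd a b := Nat.dvd_gcd hpa hpb
    rw [Nat.Coprime.gcd_eq_one hab, Nat.dvd_one] at hp1
    exact hp.one_lt.ne' hp1

/-- **The intermediate lattice of coprime indices.** If `J ⊆ I` has index `a b` with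
`gcd(a, b) = 1` (`a b ≠ 0`), there is a unique `K` with `J ⊆ K ⊆ I`, `[K : J] = a`, `[I : K] = b`,
namely `K = {x ∈ I : a x ∈ J}` (the `a`-primary part of `I / J`). [folklore] -/
theorem exists_unique_intermediate_of_coprime {J I : Submodule ℤ M} (hJI : J ≤ I) {a b : ℕ}
    (hab : Nat.Coprime a b) (hab0 : a * b ≠ 0)
    (hidx : J.toAddSubgroup.relIndex I.toAddSubgroup = a * b) :
    ∃ K : Submodule ℤ M, J ≤ K ∧ K ≤ I ∧ J.toAddSubgroup.relIndex K.toAddSubgroup = a ∧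
      K.toAddSubgroup.relIndex I.toAddSubgroup = b ∧
      ∀ K' : Submodule ℤ M, J ≤ K' → K' ≤ I →
        J.toAddSubgroup.relIndex K'.toAddSubgroup = a → K' = K := by
  have ha0 : a ≠ 0 := left_ne_zero_of_mul hab0
  have hb0 : b ≠ 0 := right_ne_zero_of_mul hab0
  -- the two primary parts
  let Ka : Submodule ℤ M := I ⊓ J.comap ((a : ℤ) • LinearMap.id)
  let Kb : Submodule ℤ M := I ⊓ J.comap ((b : ℤ) • LinearMap.id)
  have memKa : ∀ {x : M}, x ∈ Ka ↔ x ∈ I ∧ a • x ∈ J := fun {x} => by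
    simp only [Ka, Submodule.mem_inf, Submodule.mem_comap, LinearMap.smul_apply, LinearMap.id_coe,
      id_eq, natCast_zsmul]
  have memKb : ∀ {x : M}, x ∈ Kb ↔ x ∈ I ∧ b • x ∈ J := fun {x} => by
    simp only [Kb, Submodule.mem_inf, Submodule.mem_comap, LinearMap.smul_apply, LinearMap.id_coe,
      id_eq, natCast_zsmul]
  -- `(a b) • I ⊆ J`
  have habI : ∀ x ∈ I, (a * b) • x ∈ J := fun x hx => by
    rw [← hidx]
    exact relIndex_nsmul_mem hx
  have hJKa : J ≤ Ka := fun x hx => memKa.mpr ⟨hJI hx, nsmul_mem hx _⟩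
  have hJKb : J ≤ Kb := fun x hx => memKb.mpr ⟨hJI hx, nsmul_mem hx _⟩
  have hKaI : Ka ≤ I := fun x hx => (memKa.mp hx).1
  have hKbI : Kb ≤ I := fun x hx => (memKb.mp hx).1
  -- Bezout
  obtain ⟨u, v, huv⟩ := Nat.isCoprime_iff_coprime.mpr hab
  have hdecomp : ∀ x : M, x = u • (a • x) + v • (b • x) := fun x => by
    rw [← natCast_zsmul x a, ← natCast_zsmul x b, smul_smul, smul_smul, ← add_smul, huv, one_smul]
  have hinf : Ka ⊓ Kb = J := by
    refine le_antisymm (fun x hx => ?_) (le_inf hJKa hJKb)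
    rw [hdecomp x]
    exact J.add_mem (J.smul_mem _ (memKa.mp hx.1).2) (J.smul_mem _ (memKb.mp hx.2).2)
  have hsup : Ka ⊔ Kb = I := by
    refine le_antisymm (sup_le hKaI hKbI) fun x hx => ?_
    have hax : a • x ∈ Kb := memKb.mpr ⟨nsmul_mem hx _, by rw [smul_smul, mul_comm]; exact habI x hx⟩
    have hbx : b • x ∈ Ka := memKa.mpr ⟨nsmul_mem hx _, by rw [smul_smul]; exact habI x hx⟩
    rw [hdecomp x]
    exact Submodule.add_mem _ (Submodule.mem_sup_right (Kb.smul_mem u hax))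
      (Submodule.mem_sup_left (Ka.smul_mem v hbx))
  -- passage to additive subgroups
  have hinfA : Ka.toAddSubgroup ⊓ Kb.toAddSubgroup = J.toAddSubgroup := by
    rw [← hinf]
    exact (AddSubgroup.ext fun _ => Iff.rfl)
  have hsupA : Kb.toAddSubgroup ⊔ Ka.toAddSubgroup = I.toAddSubgroup := by
    rw [← Submodule.sup_toAddSubgroup, sup_comm, hsup]
  -- (ii) `[I : Ka] = [Kb : J]`
  have hii : Ka.toAddSubgroup.relIndex I.toAddSubgroup =
      J.toAddSubgroup.relIndex Kb.toAddSubgroup := by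
    rw [← hsupA, AddSubgroup.relIndex_sup_right, ← AddSubgroup.inf_relIndex_right, hinfA]
  -- (i) tower `[Ka : J] [I : Ka] = a b`
  have htower := AddSubgroup.relIndex_mul_relIndex J.toAddSubgroup Ka.toAddSubgroup I.toAddSubgroup
    (Submodule.toAddSubgroup_mono hJKa) (Submodule.toAddSubgroup_mono hKaI)
  rw [hidx, hii] at htower
  set x := J.toAddSubgroup.relIndex Ka.toAddSubgroup with hxdef
  set y := J.toAddSubgroup.relIndex Kb.toAddSubgroup with hydef
  have hxy0 : x * y ≠ 0 := by rw [htower]; exact hab0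
  have hx : Nat.Coprime x b :=
    coprime_relIndex_of_nsmul_le hab (fun z hz => (memKa.mp hz).2) (left_ne_zero_of_mul hxy0)
  have hy : Nat.Coprime y a :=
    coprime_relIndex_of_nsmul_le hab.symm (fun z hz => (memKb.mp hz).2) (right_ne_zero_of_mul hxy0)
  have hxa : x ∣ a := hx.dvd_of_dvd_mul_right (Dvd.intro y htower)
  have hyb : y ∣ b := hy.dvd_of_dvd_mul_right (Dvd.intro x (by rw [mul_comm y x, htower, mul_comm]))
  obtain ⟨c, hc⟩ := hxa
  obtain ⟨d, hd⟩ := hyb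
  have hcd : c * d = 1 := by
    have h : x * y * (c * d) = x * y * 1 := by
      calc x * y * (c * d) = (x * c) * (y * d) := by ring
        _ = a * b := by rw [← hc, ← hd]
        _ = x * y * 1 := by rw [mul_one, htower]
    exact mul_left_cancel₀ hxy0 h
  have hc1 : c = 1 := Nat.eq_one_of_mul_eq_one_right hcd
  have hd1 : d = 1 := Nat.eq_one_of_mul_eq_one_left hcd
  rw [hc1, mul_one] at hc
  rw [hd1, mul_one] at hd
  -- `hc : a = x`, `hd : b = y`
  refine ⟨Ka, hJKa, hKaI, hc.symm, by rw [hii, ← hd], fun K' hJK' hK'I hidx' => ?_⟩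
  -- uniqueness
  have hK'le : K' ≤ Ka := fun z hz => memKa.mpr ⟨hK'I hz, by rw [← hidx']; exact relIndex_nsmul_mem hz⟩
  have ht1 := AddSubgroup.relIndex_mul_relIndex J.toAddSubgroup K'.toAddSubgroup I.toAddSubgroup
    (Submodule.toAddSubgroup_mono hJK') (Submodule.toAddSubgroup_mono hK'I)
  have ht2 := AddSubgroup.relIndex_mul_relIndex K'.toAddSubgroup Ka.toAddSubgroup I.toAddSubgroup
    (Submodule.toAddSubgroup_mono hK'le) (Submodule.toAddSubgroup_mono hKaI)
  rw [hidx', hidx] at ht1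
  -- `[I : K'] = b`
  have hK'I' : K'.toAddSubgroup.relIndex I.toAddSubgroup = b := mul_left_cancel₀ ha0 ht1
  rw [hK'I', hii, ← hd] at ht2
  -- `[Ka : K'] * b = b`
  have h1 : K'.toAddSubgroup.relIndex Ka.toAddSubgroup = 1 := by
    have : K'.toAddSubgroup.relIndex Ka.toAddSubgroup * b = 1 * b := by rw [one_mul]; exact ht2
    exact mul_right_cancel₀ hb0 this
  exact le_antisymm hK'le ((Submodule.toAddSubgroup_le _ _).mp (AddSubgroup.relIndex_eq_one.mp h1))

end Intermediate

/-! ### The double count -/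

namespace Brandt

variable {D : Type u} [Ring D]

/-- **Pairs `(L, M)` versus sub-ideals `M` of index `(mn)²`.** Let `m, n ≥ 1` be coprime, `O`
an order datum whose invertible right ideals are stable under left translation by units and
under passing to intermediate lattices of coprime indices. Then `M ↦ (L(M), M)`, `L(M)` the unique
lattice with `M ⊆ L ⊆ I_j`, `[I_j : L] = n²`, `[L : M] = m²`, is a bijection from
`{M ⊆ I_j : [I_j : M] = (mn)², M = α I_i}` onto the set of pairs `(L, M)` with `L ⊆ I_j` an
invertible right `O`-ideal of index `n²` and `M ⊆ L` of index `m²`, `M = α I_i`.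
Stated as `Nonempty (_ ≃ _)`. [cite: Eichler1973, Ch. II §6 Thm. 2 (18) and (23)] -/
theorem nonempty_equiv_pairs {O : Submodule ℤ D}
    (hcl : ∀ I ∈ rightIdeals O, ∀ β : Dˣ, β • I ∈ rightIdeals O)
    (hK : ∀ M ∈ rightIdeals O, ∀ I ∈ rightIdeals O, ∀ K : Submodule ℤ D, M ≤ K → K ≤ I →
      Nat.Coprime (M.toAddSubgroup.relIndex K.toAddSubgroup)
        (K.toAddSubgroup.relIndex I.toAddSubgroup) → K ∈ rightIdeals O)
    {m n : ℕ} (hm : m ≠ 0) (hn : n ≠ 0) (hmn : Nat.Coprime m n) (i j : ClassSet O) :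
    Nonempty ({M : Submodule ℤ D // M ≤ j.rep ∧
        M.toAddSubgroup.relIndex j.rep.toAddSubgroup = (m * n) ^ 2 ∧ ∃ α : Dˣ, M = α • i.rep} ≃
      {p : Submodule ℤ D × Submodule ℤ D // (p.1 ≤ j.rep ∧
        p.1.toAddSubgroup.relIndex j.rep.toAddSubgroup = n ^ 2 ∧ p.1 ∈ rightIdeals O) ∧
        (p.2 ≤ p.1 ∧ p.2.toAddSubgroup.relIndex p.1.toAddSubgroup = m ^ 2 ∧
          ∃ α : Dˣ, p.2 = α • i.rep)}) := by
  classical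
  have hcop : Nat.Coprime (m ^ 2) (n ^ 2) := Nat.Coprime.pow 2 2 hmn
  have hmn0 : m ^ 2 * n ^ 2 ≠ 0 := mul_ne_zero (pow_ne_zero 2 hm) (pow_ne_zero 2 hn)
  -- the intermediate lattice of an `M` in the left-hand set
  have hex : ∀ M : {M : Submodule ℤ D // M ≤ j.rep ∧
      M.toAddSubgroup.relIndex j.rep.toAddSubgroup = (m * n) ^ 2 ∧ ∃ α : Dˣ, M = α • i.rep},
      ∃ K : Submodule ℤ D, M.1 ≤ K ∧ K ≤ j.rep ∧
        M.1.toAddSubgroup.relIndex K.toAddSubgroup = m ^ 2 ∧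
        K.toAddSubgroup.relIndex j.rep.toAddSubgroup = n ^ 2 ∧
        ∀ K' : Submodule ℤ D, M.1 ≤ K' → K' ≤ j.rep →
          M.1.toAddSubgroup.relIndex K'.toAddSubgroup = m ^ 2 → K' = K := fun M =>
    exists_unique_intermediate_of_coprime M.2.1 hcop hmn0 (by rw [M.2.2.1]; ring)
  choose L hML hLI hidxML hidxLI huniq using hex
  have hLmem : ∀ M, L M ∈ rightIdeals O := fun M => by
    obtain ⟨α, hα⟩ := M.2.2.2
    have hMmem : M.1 ∈ rightIdeals O := by rw [hα]; exact hcl _ i.rep_mem α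
    exact hK M.1 hMmem j.rep j.rep_mem (L M) (hML M) (hLI M) (by rw [hidxML, hidxLI]; exact hcop)
  -- backward: the tower `[I_j : M] = [L : M] [I_j : L]`
  have bwd : ∀ p : {p : Submodule ℤ D × Submodule ℤ D // (p.1 ≤ j.rep ∧
      p.1.toAddSubgroup.relIndex j.rep.toAddSubgroup = n ^ 2 ∧ p.1 ∈ rightIdeals O) ∧
      (p.2 ≤ p.1 ∧ p.2.toAddSubgroup.relIndex p.1.toAddSubgroup = m ^ 2 ∧
        ∃ α : Dˣ, p.2 = α • i.rep)},
      p.1.2 ≤ j.rep ∧ p.1.2.toAddSubgroup.relIndex j.rep.toAddSubgroup = (m * n) ^ 2 ∧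
        ∃ α : Dˣ, p.1.2 = α • i.rep := fun p => by
    refine ⟨p.2.2.1.trans p.2.1.1, ?_, p.2.2.2.2⟩
    rw [← AddSubgroup.relIndex_mul_relIndex p.1.2.toAddSubgroup p.1.1.toAddSubgroup
      j.rep.toAddSubgroup (Submodule.toAddSubgroup_mono p.2.2.1)
      (Submodule.toAddSubgroup_mono p.2.1.1), p.2.2.2.1, p.2.1.2.1]
    ring
  refine ⟨⟨fun M => ⟨(L M, M.1), ⟨hLI M, hidxLI M, hLmem M⟩, hML M, hidxML M, M.2.2.2⟩,
    fun p => ⟨p.1.2, bwd p⟩, fun M => Subtype.ext rfl, fun p => Subtype.ext ?_⟩⟩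
  -- uniqueness of the intermediate lattice: `L(M) = p.1`
  have hLp : L ⟨p.1.2, bwd p⟩ = p.1.1 :=
    (huniq ⟨p.1.2, bwd p⟩ p.1.1 p.2.2.1 p.2.1.1 p.2.2.2.1).symm
  show (L ⟨p.1.2, bwd p⟩, p.1.2) = p.1
  rw [hLp]

/-- **The pairs are counted by `(T(m) T(n))_ij`**: grouping the pairs `(L, M)` by the class
`k = [L]` of `L = β I_k`, and computing `T(m)_ik` on the representative `L` of `k`
(`#{M ⊆ L : [L : M] = m², M ∈ Dˣ I_i} = T(m)_ik`, `ncard_brandtSet_smul`), gives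
`#pairs = Σ_k T(m)_ik T(n)_kj`. [cite: Eichler1973, Ch. II §6 Thm. 2 (18) and (23)] -/
theorem card_pairs_eq_sum [IsAddTorsionFree D] {O : Submodule ℤ D} [Fintype (ClassSet O)]
    (hcl : ∀ I ∈ rightIdeals O, ∀ β : Dˣ, β • I ∈ rightIdeals O)
    {m n : ℕ} (hm : m ≠ 0) (hn : n ≠ 0) (i j : ClassSet O) :
    Nat.card {p : Submodule ℤ D × Submodule ℤ D // (p.1 ≤ j.rep ∧
        p.1.toAddSubgroup.relIndex j.rep.toAddSubgroup = n ^ 2 ∧ p.1 ∈ rightIdeals O) ∧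
        (p.2 ≤ p.1 ∧ p.2.toAddSubgroup.relIndex p.1.toAddSubgroup = m ^ 2 ∧
          ∃ α : Dˣ, p.2 = α • i.rep)} =
      ∑ k : ClassSet O,
        {M : Submodule ℤ D | M ≤ k.rep ∧ M.toAddSubgroup.relIndex k.rep.toAddSubgroup = m ^ 2 ∧
            ∃ α : Dˣ, M = α • i.rep}.ncard *
        {L : Submodule ℤ D | L ≤ j.rep ∧ L.toAddSubgroup.relIndex j.rep.toAddSubgroup = n ^ 2 ∧
            ∃ β : Dˣ, L = β • k.rep}.ncard := by
  classical
  -- the sets involved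
  set U : Set (Submodule ℤ D) := {L | L ≤ j.rep ∧
    L.toAddSubgroup.relIndex j.rep.toAddSubgroup = n ^ 2 ∧ L ∈ rightIdeals O} with hU
  set B : ClassSet O → Set (Submodule ℤ D) := fun k => {L | L ≤ j.rep ∧
    L.toAddSubgroup.relIndex j.rep.toAddSubgroup = n ^ 2 ∧ ∃ β : Dˣ, L = β • k.rep} with hB
  set C : Submodule ℤ D → Set (Submodule ℤ D) := fun L' => {M | M ≤ L' ∧
    M.toAddSubgroup.relIndex L'.toAddSubgroup = m ^ 2 ∧ ∃ α : Dˣ, M = α • i.rep} with hC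
  set big : Set (Submodule ℤ D) := {M | M ≤ j.rep ∧
    M.toAddSubgroup.relIndex j.rep.toAddSubgroup = (m * n) ^ 2 ∧ True} with hbig
  have hUfin : U.Finite := finite_setOf_subideal j.rep_mem.1.1 hn _
  have hBfin : ∀ k, (B k).Finite := fun k => finite_brandtSet k j hn
  have hbigfin : big.Finite := finite_setOf_subideal j.rep_mem.1.1 (mul_ne_zero hm hn) _
  -- for `L ∈ U`, `C L ⊆ big`
  have hCbig : ∀ L' ∈ U, C L' ⊆ big := by
    rintro L' ⟨hle, hidx, -⟩ M ⟨hML, hidxM, -⟩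
    refine ⟨hML.trans hle, ?_, trivial⟩
    rw [← AddSubgroup.relIndex_mul_relIndex M.toAddSubgroup L'.toAddSubgroup j.rep.toAddSubgroup
      (Submodule.toAddSubgroup_mono hML) (Submodule.toAddSubgroup_mono hle), hidxM, hidx]
    ring
  -- `U` is the disjoint union of the `B k`
  have hmemU : ∀ L', L' ∈ U ↔ ∃ k, L' ∈ B k := fun L' => by
    constructor
    · rintro ⟨hle, hidx, hmem⟩
      obtain ⟨β, hβ⟩ := exists_rep_mk_eq_smul (⟨L', hmem⟩ : rightIdeals O)
      refine ⟨Quotient.mk (rightClassSetoid O) ⟨L', hmem⟩, hle, hidx, β⁻¹, ?_⟩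
      rw [hβ, inv_smul_smul]
    · rintro ⟨k, hle, hidx, β, rfl⟩
      exact ⟨hle, hidx, hcl _ k.rep_mem β⟩
  have hdisj : ∀ k k', k ≠ k' → Disjoint (B k) (B k') := fun k k' hkk' => by
    rw [Set.disjoint_left]
    rintro L' ⟨-, -, β, hβ⟩ ⟨-, -, β', hβ'⟩
    apply hkk'
    have h : k'.rep = (β'⁻¹ * β) • k.rep := by rw [mul_smul, ← hβ, hβ', inv_smul_smul]
    exact ClassSet.eq_of_rep_eq_smul h
  -- `#C(L) = T(m)_ik` for `L ∈ B k`
  have hCB : ∀ k, ∀ L' ∈ B k, (C L').ncard = (C k.rep).ncard := by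
    rintro k L' ⟨-, -, β, rfl⟩
    have h := ncard_brandtSet_smul β 1 m i.rep k.rep
    rw [one_smul] at h
    exact h
  -- Finsets
  let S : Finset (Submodule ℤ D) := hUfin.toFinset
  let T : Submodule ℤ D → Finset (Submodule ℤ D) := fun L' => hbigfin.toFinset.filter (· ∈ C L')
  have hmemS : ∀ L', L' ∈ S ↔ L' ∈ U := fun L' => Set.Finite.mem_toFinset hUfin
  have hmemT : ∀ L' ∈ U, ∀ M, M ∈ T L' ↔ M ∈ C L' := fun L' hL' M => by
    simp only [T, Finset.mem_filter, Set.Finite.mem_toFinset]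
    exact ⟨fun h => h.2, fun h => ⟨hCbig L' hL' h, h⟩⟩
  -- Step 1: the pairs are the sigma-finset `S.sigma T`
  have hstep1 : Nat.card {p : Submodule ℤ D × Submodule ℤ D // (p.1 ≤ j.rep ∧
      p.1.toAddSubgroup.relIndex j.rep.toAddSubgroup = n ^ 2 ∧ p.1 ∈ rightIdeals O) ∧
      (p.2 ≤ p.1 ∧ p.2.toAddSubgroup.relIndex p.1.toAddSubgroup = m ^ 2 ∧
        ∃ α : Dˣ, p.2 = α • i.rep)} = (S.sigma T).card := by
    rw [← Nat.card_eq_finsetCard]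
    refine Nat.card_congr
      { toFun := fun p => ⟨⟨p.1.1, p.1.2⟩, Finset.mem_sigma.mpr
          ⟨(hmemS _).mpr p.2.1, (hmemT _ p.2.1 _).mpr p.2.2⟩⟩
        invFun := fun q => ⟨(q.1.1, q.1.2), (hmemS _).mp (Finset.mem_sigma.mp q.2).1,
          (hmemT _ ((hmemS _).mp (Finset.mem_sigma.mp q.2).1) _).mp (Finset.mem_sigma.mp q.2).2⟩
        left_inv := fun p => rfl
        right_inv := fun q => rfl }
  -- Step 2: `card (S.sigma T) = Σ_{L ∈ S} #C(L)`
  have hstep2 : (S.sigma T).card = ∑ L' ∈ S, (C L').ncard := by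
    rw [Finset.card_sigma]
    refine Finset.sum_congr rfl fun L' hL' => ?_
    have hL'U : L' ∈ U := (hmemS L').mp hL'
    have hset : ((T L' : Finset (Submodule ℤ D)) : Set (Submodule ℤ D)) = C L' :=
      Set.ext fun M => by rw [Finset.mem_coe]; exact hmemT L' hL'U M
    rw [← hset, Set.ncard_coe_finset]
  -- Step 3: `S` is the disjoint union of the `B k`
  have hS : S = Finset.univ.biUnion fun k => (hBfin k).toFinset := by
    ext L'
    rw [hmemS, hmemU, Finset.mem_biUnion]
    simp only [Finset.mem_univ, true_and, Set.Finite.mem_toFinset]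
  have hpd : (↑(Finset.univ : Finset (ClassSet O)) : Set (ClassSet O)).PairwiseDisjoint
      fun k => (hBfin k).toFinset := fun k _ k' _ hkk' =>
    Set.Finite.disjoint_toFinset.mpr (hdisj k k' hkk')
  have hstep3 : ∑ L' ∈ S, (C L').ncard = ∑ k, ∑ L' ∈ (hBfin k).toFinset, (C L').ncard := by
    rw [hS, Finset.sum_biUnion hpd]
  -- Step 4: the inner sums are `#B(k) · T(m)_ik`
  have hstep4 : ∀ k, ∑ L' ∈ (hBfin k).toFinset, (C L').ncard = (C k.rep).ncard * (B k).ncard :=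
    fun k => by
    rw [Finset.sum_congr rfl fun L' hL' => hCB k L' ((Set.Finite.mem_toFinset _).mp hL'),
      Finset.sum_const, smul_eq_mul, mul_comm, ← Set.ncard_eq_toFinset_card (B k) (hBfin k)]
  rw [hstep1, hstep2, hstep3]
  exact Finset.sum_congr rfl fun k _ => hstep4 k

/-- **`T(mn) = T(m) T(n)` for coprime `m, n`, from the invertibility of intermediate lattices**
(Vignéras III §5 Ex. 5.8 (c); Eichler 1973 II §6 Thm. 2 (18), proof (23)): for an order datum
`O` in an additively torsion-free ring whose invertible right ideals `Brandt.rightIdeals O` are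
stable under left translation by units and under passing to intermediate lattices of coprime
indices, the Brandt matrices are multiplicative on coprime arguments. [cite: VignerasLNM800, Ch. III §5 exercice 5.8 (c)] -/
theorem matrix_mul_of_coprime_of_forall_mem_rightIdeals [IsAddTorsionFree D] {O : Submodule ℤ D}
    [Fintype (ClassSet O)] [DecidableEq (ClassSet O)]
    (hcl : ∀ I ∈ rightIdeals O, ∀ β : Dˣ, β • I ∈ rightIdeals O)
    (hK : ∀ M ∈ rightIdeals O, ∀ I ∈ rightIdeals O, ∀ K : Submodule ℤ D, M ≤ K → K ≤ I →
      Nat.Coprime (M.toAddSubgroup.relIndex K.toAddSubgroup)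
        (K.toAddSubgroup.relIndex I.toAddSubgroup) → K ∈ rightIdeals O)
    {m n : ℕ} (hmn : Nat.Coprime m n) : matrix O (m * n) = matrix O m * matrix O n := by
  rcases eq_or_ne m 0 with rfl | hm
  · rw [Nat.coprime_zero_left] at hmn
    rw [hmn, zero_mul, matrix_one, Matrix.mul_one]
  rcases eq_or_ne n 0 with rfl | hn
  · rw [Nat.coprime_zero_right] at hmn
    rw [hmn, mul_zero, matrix_one, Matrix.one_mul]
  ext i j
  rw [Matrix.mul_apply]
  obtain ⟨e⟩ := nonempty_equiv_pairs hcl hK hm hn hmn i j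
  have h := card_pairs_eq_sum hcl hm hn i j
  rw [← Nat.card_congr e] at h
  have hL : matrix O (m * n) i j = (Nat.card {M : Submodule ℤ D // M ≤ j.rep ∧
      M.toAddSubgroup.relIndex j.rep.toAddSubgroup = (m * n) ^ 2 ∧ ∃ α : Dˣ, M = α • i.rep} : ℤ) := by
    rw [matrix, Matrix.of_apply, ← Nat.card_coe_set_eq]
    rfl
  rw [hL, h]
  push_cast
  refine Finset.sum_congr rfl fun k _ => ?_
  simp only [matrix, Matrix.of_apply]

/-- **`T(m) T(n) = T(n) T(m)` for coprime `m, n`** under the same hypotheses (both equal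
`T(mn)`; Vignéras III §5 Ex. 5.8 (d); Eichler 1973 II §6 Thm. 2). [cite: VignerasLNM800, Ch. III §5 exercice 5.8 (c)–(d)] -/
theorem matrix_comm_of_coprime_of_forall_mem_rightIdeals [IsAddTorsionFree D] {O : Submodule ℤ D}
    [Fintype (ClassSet O)] [DecidableEq (ClassSet O)]
    (hcl : ∀ I ∈ rightIdeals O, ∀ β : Dˣ, β • I ∈ rightIdeals O)
    (hK : ∀ M ∈ rightIdeals O, ∀ I ∈ rightIdeals O, ∀ K : Submodule ℤ D, M ≤ K → K ≤ I →
      Nat.Coprime (M.toAddSubgroup.relIndex K.toAddSubgroup)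
        (K.toAddSubgroup.relIndex I.toAddSubgroup) → K ∈ rightIdeals O)
    {m n : ℕ} (hmn : Nat.Coprime m n) : matrix O m * matrix O n = matrix O n * matrix O m := by
  rw [← matrix_mul_of_coprime_of_forall_mem_rightIdeals hcl hK hmn,
    ← matrix_mul_of_coprime_of_forall_mem_rightIdeals hcl hK hmn.symm, mul_comm]

end Brandt

end Literature.NumberTheory.Automorphic

end
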